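import Literature.Barriers.Parity.SiegelZeroDichotomyPairHLProp52
import Literature.Barriers.Parity.SiegelZeroPrimePairsFixedShift
import HarnessLib

/-!
# `SiegelZeroTwinPrimes` from its one remaining input

Topic `Literature/Barriers/Parity`, companion of the catalogue entry `SiegelZeroDichotomy.lean`
(`Literature.Barriers.Parity.SiegelZeroTwinPrimes := UnboundedSiegelZeros → TwinPrimeConjecture`,
Heath-Brown's Siegel-zero dichotomy in the quality form of Tao–Teräväinen, D-0021), kept separate so
that the statement file and its companions are unchanged. All declarations here are PROVED theorems;
no definitions, no named facts.

The tree holds two proved reductions of the record to a theorem of the literature and, below each,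
proved glue down to a single unproved step:

* Tao–Teräväinen, Corollary 1.8 (i) (`TaoTeravainen2021_pairHL`, `SiegelZeroDichotomyPairHL.lean`;
  the record from it: `SiegelZeroTwinPrimes_of_pairHL`). The source: "As a direct corollary to
  Theorem 1.6 theorem, we can state … Corollary 1.8" (arXiv p. 4) and "Clearly Theorem 1.6 follows
  immediately from concatenating together Propositions 4.2, 5.2, 6.3, 7.2, 8.1" (§8, first
  paragraph); at `k = 2`, `ℓ = 0` the chain is Proposition 5.2 then Propositions 7.2 + 8.1
  (`TaoTeravainen2021_pairHL_of_siegelModel`, `SiegelZeroDichotomyPairHLSiegelModel.lean`), and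
  Proposition 5.2 is PROVED (`TaoTeravainen2021_prop52_pair_holds`,
  `SiegelZeroDichotomyPairHLProp52.lean`). What remains is exactly the named fact
  `Literature.Barriers.Parity.TaoTeravainen2021_prop72_81_pair` (Propositions 7.2 and 8.1 at `k = 2`).
* Matomäki–Merikoski, Corollary 1.1 (i) (`MatomakiMerikoski2023_fixedShift`; the record from it:
  `SiegelZeroTwinPrimes_of_matomakiMerikoski` in the statement file), itself PROVED from their
  Theorem 1.3 (`MatomakiMerikoski2023_fixedShift_of_pairCorrelation`,
  `SiegelZeroPrimePairsFixedShift.lean`). What remains is the named fact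
  `Literature.Barriers.Parity.MatomakiMerikoski2023_pairCorrelation` (Theorem 1.3).

This file composes the glue, so that the discharge `SiegelZeroTwinPrimes_holds` is ONE application
away from either remaining step, and the dependency of the record on each step is an explicit
hypothesis `(h : …)`:

* `TaoTeravainen2021_pairHL_of_prop72_81_pair` — Corollary 1.8 (i) from Propositions 7.2 + 8.1
  (`k = 2`), Proposition 5.2 being proved;
* `SiegelZeroTwinPrimes_of_prop72_81_pair`, `not_twinPrime_bounds_siegelZeros_of_prop72_81_pair` —
  the record and its no-go from that step;
* `SiegelZeroTwinPrimes_of_pairCorrelation`, `not_twinPrime_bounds_siegelZeros_of_pairCorrelation` —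
  the record and its no-go from Matomäki–Merikoski's Theorem 1.3.

## References

* T. Tao, J. Teräväinen, *The Hardy–Littlewood–Chowla conjecture in the presence of a Siegel
  zero*, J. London Math. Soc. (2) 106 (2022), 3317–3378, arXiv:2109.06291 — read on the page:
  Definition 1.4, Theorem 1.5 (i), Theorem 1.6, Corollary 1.8 (i) (arXiv pp. 3–4), §8 first
  paragraph (arXiv p. 39). [TaoTeravainen2021]
* K. Matomäki, J. Merikoski, *Siegel zeros, twin primes, Goldbach's conjecture, and primes in short
  intervals*, IMRN 2023:23, 20337–20384, arXiv:2112.11412 — Corollary 1.1 (i), Theorem 1.3 (as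
  vendored in `SiegelZeroPrimePairs.lean`). [MatomakiMerikoski2023]
-/

noncomputable section

namespace Literature.Barriers.Parity

/-! ### Via Tao–Teräväinen, Corollary 1.8 (i) -/

/-- **Corollary 1.8 (i) from its remaining step.** "Clearly Theorem 1.6 follows immediately from
concatenating together Propositions 4.2, 5.2, 6.3, 7.2, 8.1"; at `k = 2`, `ℓ = 0` only
Propositions 5.2 (proved: `TaoTeravainen2021_prop52_pair_holds`) and 7.2 + 8.1
(`TaoTeravainen2021_prop72_81_pair`) enter, assembled by `TaoTeravainen2021_pairHL_of_siegelModel`.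
[cite: TaoTeravainen2021, §8 (first paragraph) and Corollary 1.8 (i)] -/
theorem TaoTeravainen2021_pairHL_of_prop72_81_pair (h : TaoTeravainen2021_prop72_81_pair) :
    TaoTeravainen2021_pairHL :=
  TaoTeravainen2021_pairHL_of_siegelModel TaoTeravainen2021_prop52_pair_holds h

/-- **Heath-Brown's dichotomy from the remaining step of Tao–Teräväinen's proof**: given
Propositions 7.2 + 8.1 at `k = 2` (`TaoTeravainen2021_prop72_81_pair`), Siegel zeros of unbounded
quality at arbitrarily large conductors imply the twin prime conjecture
(`SiegelZeroTwinPrimes_of_pairHL` after `TaoTeravainen2021_pairHL_of_prop72_81_pair`).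
[cite: TaoTeravainen2021, Theorem 1.5 (i), Corollary 1.8 (i) and §8 (first paragraph)] -/
theorem SiegelZeroTwinPrimes_of_prop72_81_pair (h : TaoTeravainen2021_prop72_81_pair) :
    SiegelZeroTwinPrimes :=
  SiegelZeroTwinPrimes_of_pairHL (TaoTeravainen2021_pairHL_of_prop72_81_pair h)

/-- The no-go for disproofs, modulo the remaining step of Tao–Teräväinen's proof: if the twin
prime conjecture fails, the quality of Siegel zeros is bounded at large conductors.
[cite: TaoTeravainen2021, Corollary 1.8 (i) and (1.4)] -/
theorem not_twinPrime_bounds_siegelZeros_of_prop72_81_pair (h : TaoTeravainen2021_prop72_81_pair)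
    (hno : ¬ Literature.NumberTheory.Sieve.TwinPrimeConjecture) :
    ∃ η₀ : ℝ, ∃ q₀ : ℕ, ∀ (q : ℕ) [NeZero q] (χ : DirichletCharacter ℂ q) (η : ℝ),
      q₀ ≤ q → IsSiegelZero χ η → η < η₀ :=
  (SiegelZeroTwinPrimes_of_prop72_81_pair h).disproof_bounds_quality hno

/-! ### Via Matomäki–Merikoski, Theorem 1.3 -/

/-- **Heath-Brown's dichotomy from Matomäki–Merikoski's Theorem 1.3**: Theorem 1.3
(`MatomakiMerikoski2023_pairCorrelation`) gives Corollary 1.1 (i)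
(`MatomakiMerikoski2023_fixedShift_of_pairCorrelation`, "Corollaries 1.1(i) and 1.2 immediately
follow from Theorems 1.3 and 1.4 since by Siegel's theorem `η ≪_ε q^ε`"), whence the record
(`SiegelZeroTwinPrimes_of_matomakiMerikoski`).
[cite: MatomakiMerikoski2023, Theorem 1.3 and Corollary 1.1(i)] -/
theorem SiegelZeroTwinPrimes_of_pairCorrelation (h : MatomakiMerikoski2023_pairCorrelation) :
    SiegelZeroTwinPrimes :=
  SiegelZeroTwinPrimes_of_matomakiMerikoski (MatomakiMerikoski2023_fixedShift_of_pairCorrelation h)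

/-- The no-go for disproofs, modulo Matomäki–Merikoski's Theorem 1.3.
[cite: MatomakiMerikoski2023, Theorem 1.3 and Corollary 1.1(i)] -/
theorem not_twinPrime_bounds_siegelZeros_of_pairCorrelation
    (h : MatomakiMerikoski2023_pairCorrelation)
    (hno : ¬ Literature.NumberTheory.Sieve.TwinPrimeConjecture) :
    ∃ η₀ : ℝ, ∃ q₀ : ℕ, ∀ (q : ℕ) [NeZero q] (χ : DirichletCharacter ℂ q) (η : ℝ),
      q₀ ≤ q → IsSiegelZero χ η → η < η₀ :=
  (SiegelZeroTwinPrimes_of_pairCorrelation h).disproof_bounds_quality hno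

end Literature.Barriers.Parity
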